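import Summits.CriticalPhenomena.CardyFormulaZ2.Theses.CardyDualCurrent
import Literature.Probability.RandomPlanarGeometry.ConformalMapProofs

/-!
# The cube-root branch in `TemplateCanonicalLimit` is immaterial (crux stmt-CriticalPhenomena-11395)

Route `CardyDualCurrent`, sub-problem `CriticalPhenomena/CardyFormulaZ2`, crux `MartingaleToSLE6`
(`TemplateCanonicalLimit → SLE6InterfaceLimit`), line `registered`, lead c7.

The antecedent `TemplateCanonicalLimit` (and verbatim the consequent of the sibling crux
`CanonicalLimitFromExactCR`) quantifies, for every Dobrushin domain `D`, family `E` and chordal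
uniformizer `φ` (inverse `ψ = φ.symm`), over EVERY holomorphic branch `q` of `(ψ'/ψ)^(1/3)` on the
carrier and asks for unit phases `θ_δ` with `θ_δ · C · δ^(-1/3) · G (E δ) → q` locally uniformly.
This file records, kernel-checked, that the quantifier "every branch" is harmless:

* `MartingaleToSLE6Branches.exists_eq_const_mul_of_pow_three_eq` — two continuous cube roots of
  one non-vanishing function on a preconnected set differ by a constant cube root of unity (the
  ratio is continuous with values in the finite set `{ω | ω³ = 1}`);
* `MartingaleToSLE6Branches.deriv_symm_div_ne_zero` — on the carrier, `ψ'/ψ ≠ 0` (`ψ` maps into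
  `ℍₒ`, so `ψ ≠ 0`, and `ψ' ≠ 0` by `ConformalEquiv.deriv_ne_zero_holds`);
* `templateCanonicalLimit_of_oneBranch` — hence the ONE-BRANCH form of the antecedent (for every
  `(D, E, φ)` SOME holomorphic branch `q` with the convergence) already implies
  `TemplateCanonicalLimit`: another branch is `ω · q` with `ω³ = 1`, `‖ω‖ = 1`, and the phases
  `ω · θ_δ` serve it. A prover of `TemplateCanonicalLimit` / `CanonicalLimitFromExactCR` may thus
  fix one branch per uniformizer; and no refutation of the antecedent can come from the branch
  quantifier (escape (a) of the lead-c7 audit, `Cruxes/MartingaleToSLE6/Lines/registered-dead-c7.md`).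
-/

noncomputable section

namespace Summit.CriticalPhenomena.CardyFormulaZ2.Theorems

open scoped Topology ENNReal
open Filter Set Metric MeasureTheory
open Literature.Probability.LatticeModels Literature.Probability.RandomPlanarGeometry
open Literature.Probability.Percolation
open Summit.CriticalPhenomena.CardyFormulaZ2.Theses.CardyDualCurrent (TemplateCanonicalLimit)

namespace MartingaleToSLE6Branches

/-- The cube roots of unity form a finite subset of `ℂ` (roots of `X³ − 1`). [folklore] -/
theorem finite_setOf_pow_three_eq_one : {ω : ℂ | ω ^ 3 = 1}.Finite := by
  have hp : (Polynomial.X ^ 3 - Polynomial.C 1 : Polynomial ℂ) ≠ 0 :=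
    Polynomial.X_pow_sub_C_ne_zero (by norm_num) 1
  refine (Polynomial.finite_setOf_isRoot hp).subset ?_
  intro ω hω
  simp only [mem_setOf_eq] at hω
  simp only [mem_setOf_eq, Polynomial.IsRoot.def, Polynomial.eval_sub, Polynomial.eval_pow,
    Polynomial.eval_X, Polynomial.eval_C, hω, sub_self]

/-- A cube root of unity has norm one. [folklore] -/
theorem norm_eq_one_of_pow_three_eq_one {ω : ℂ} (hω : ω ^ 3 = 1) : ‖ω‖ = 1 := by
  have h : ‖ω‖ ^ 3 = 1 := by rw [← norm_pow, hω, norm_one]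
  exact (pow_eq_one_iff_of_nonneg (norm_nonneg ω) (by norm_num)).1 h

/-- **Branches of a cube root differ by a constant root of unity.** Two continuous cube roots
`q₁, q₂` of one non-vanishing function `f` on a preconnected set `U` satisfy `q₂ = ω · q₁` on `U`
for a constant `ω` with `ω³ = 1`: the ratio `q₂/q₁` is continuous on `U` with values in the finite
(hence discrete) set of cube roots of unity, so it is constant (`IsPreconnected.constant_of_mapsTo`).
[folklore] -/
theorem exists_eq_const_mul_of_pow_three_eq {U : Set ℂ} (hU : IsPreconnected U)
    {q₁ q₂ f : ℂ → ℂ} (h₁ : ContinuousOn q₁ U) (h₂ : ContinuousOn q₂ U)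
    (hf : ∀ w ∈ U, f w ≠ 0) (e₁ : ∀ w ∈ U, q₁ w ^ 3 = f w) (e₂ : ∀ w ∈ U, q₂ w ^ 3 = f w) :
    ∃ ω : ℂ, ω ^ 3 = 1 ∧ ∀ w ∈ U, q₂ w = ω * q₁ w := by
  rcases U.eq_empty_or_nonempty with hUe | ⟨w₀, hw₀⟩
  · exact ⟨1, one_pow 3, by simp [hUe]⟩
  have hq₁ : ∀ w ∈ U, q₁ w ≠ 0 := by
    intro w hw h0
    apply hf w hw
    rw [← e₁ w hw, h0]
    norm_num
  have hρc : ContinuousOn (fun w => q₂ w / q₁ w) U := h₂.div h₁ hq₁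
  have hρT : MapsTo (fun w => q₂ w / q₁ w) U {ω : ℂ | ω ^ 3 = 1} := by
    intro w hw
    simp only [mem_setOf_eq, div_pow, e₁ w hw, e₂ w hw]
    exact div_self (hf w hw)
  refine ⟨q₂ w₀ / q₁ w₀, hρT hw₀, fun w hw => ?_⟩
  have key : q₂ w / q₁ w = q₂ w₀ / q₁ w₀ :=
    hU.constant_of_mapsTo finite_setOf_pow_three_eq_one.isDiscrete hρc hρT hw hw₀
  rw [← key]
  exact (div_mul_cancel₀ (q₂ w) (hq₁ w hw)).symm

/-- On the carrier of a Dobrushin domain the logarithmic derivative `ψ'/ψ` of the inverse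
`ψ = φ.symm` of a conformal equivalence `φ : ℍₒ → D` does not vanish: `ψ w ∈ ℍₒ` is non-zero and
`ψ' w ≠ 0` (`ConformalEquiv.deriv_ne_zero_holds` on the open carrier). [folklore] -/
theorem deriv_symm_div_ne_zero (D : DobrushinDomain)
    (φ : ConformalEquiv UpperHalfPlane.upperHalfPlaneSet D.carrier) {w : ℂ} (hw : w ∈ D.carrier) :
    deriv φ.symm w / φ.symm w ≠ 0 := by
  have h1 : deriv φ.symm w ≠ 0 := ConformalEquiv.deriv_ne_zero_holds φ.symm D.isOpen hw
  have h2 : φ.symm w ≠ 0 := by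
    intro h0
    have hmem : φ.symm w ∈ UpperHalfPlane.upperHalfPlaneSet := φ.symm_mapsTo hw
    rw [h0] at hmem
    simp [UpperHalfPlane.upperHalfPlaneSet] at hmem
  exact div_ne_zero h1 h2

end MartingaleToSLE6Branches

open MartingaleToSLE6Branches

/-- **One branch suffices for `TemplateCanonicalLimit`.** If a finite-range local parafermionic
template `(r, m, z, s, g)` with lattice constant `C > 0` has, for every Dobrushin domain `D`, every
discretisation family `E` and every chordal uniformizer `φ`, SOME holomorphic branch `q` of
`(ψ'/ψ)^(1/3)` (`ψ = φ.symm`) and unit phases `θ_δ` with `θ_δ · C · δ^(-1/3) · G (E δ) ⌊w/δ⌋ i → q`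
locally uniformly on the carrier for both edge types, then the route's antecedent
`TemplateCanonicalLimit` (which asks this for EVERY branch) holds: any other branch is `ω · q` with
a constant cube root of unity `ω` (`exists_eq_const_mul_of_pow_three_eq`, the carrier being
connected and `ψ'/ψ` non-vanishing), and the phases `ω · θ_δ` serve it. The observable `G` is
verbatim that of the route. [folklore] -/
theorem templateCanonicalLimit_of_oneBranch : (∃ (r m : ℕ) (z : Fin 2 → Fin m → MedialVertex)
      (s : Fin 2 → Fin m → ℝ) (g : Fin 2 → Fin m → Set MedialVertex → ℂ) (C : ℝ), 0 < C ∧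
      (∀ i k, medialGraph.edist s((0 : Site 2), Pi.single i 1) (z i k) ≤ (r : ℕ∞)) ∧
      (let G : DiscreteDobrushin → Site 2 → Fin 2 → ℂ := fun D x i => ∫ cfg, (∑ k, g i k
          {e | medialGraph.edist s((0 : Site 2), Pi.single i 1) e ≤ (r : ℕ∞) ∧
            Sym2.map (· + x) e ∈ cfg} *
          passageSum (fkInterface D cfg) D.δ (s i k) (Sym2.map (· + x) (z i k)))
          ∂(bondPercolation (zdGraph 2) half);
      ∀ (D : DobrushinDomain) (E : ℝ → DiscreteDobrushin), ZdDiscretisationFamily D E →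
      ∀ (φ : ConformalEquiv UpperHalfPlane.upperHalfPlaneSet D.carrier),
        D.IsChordalUniformizing φ →
      ∃ q : ℂ → ℂ, DifferentiableOn ℂ q D.carrier ∧
        (∀ w ∈ D.carrier, q w ^ 3 = deriv φ.symm w / φ.symm w) ∧
        ∃ θ : ℝ → ℂ, (∀ δ, ‖θ δ‖ = 1) ∧ ∀ i : Fin 2,
          TendstoLocallyUniformlyOn (fun (δ : ℝ) (w : ℂ) => θ δ * C * ((δ ^ (-(1 / 3 : ℝ)) : ℝ) : ℂ) *
            G (E δ) (fun j => ⌊(if j = 0 then w.re else w.im) / δ⌋) i) q (𝓝[>] (0 : ℝ)) D.carrier)) →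
    TemplateCanonicalLimit := by
  intro h
  obtain ⟨r, m, z, s, g, C, hC, hrange, hlim⟩ := h
  refine ⟨r, m, z, s, g, C, hC, hrange, ?_⟩
  intro G D E hE φ hφ q hq hq3
  obtain ⟨q₀, hq₀, hq₀3, θ, hθ, hconv⟩ := hlim D E hE φ hφ
  -- the given branch `q` is a constant root-of-unity multiple of the witnessed branch `q₀`
  obtain ⟨ω, hω3, hωq⟩ := exists_eq_const_mul_of_pow_three_eq
    D.isConnected.isPreconnected hq₀.continuousOn hq.continuousOn
    (fun w hw => deriv_symm_div_ne_zero D φ hw) hq₀3 hq3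
  have hω1 : ‖ω‖ = 1 := norm_eq_one_of_pow_three_eq_one hω3
  refine ⟨fun δ => ω * θ δ, fun δ => by rw [norm_mul, hω1, hθ δ, one_mul], fun i => ?_⟩
  -- multiply the witnessed convergence by the constant `ω`
  have hmul := (uniformContinuous_mul_left' ω).comp_tendstoLocallyUniformlyOn (hconv i)
  refine (hmul.congr ?_).congr_right ?_
  · intro δ w _
    simp only [Function.comp_apply, mul_assoc]
    rfl
  · intro w hw
    simp only [Function.comp_apply]
    exact (hωq w hw).symm

/-! ### One uniformizer suffices (modulo uniqueness of chordal uniformizers up to dilation)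

Appended by lead c7 (same session): the quantifier "every chordal uniformizer `φ`" of
`TemplateCanonicalLimit` is immaterial as well, modulo the Literature named fact
`MarkedDomain.IsChordalUniformizing.exists_eq_trans_smul` (two chordal uniformizers of one
Dobrushin domain differ by a dilation of `ℍₒ`; unproved in the tree, taken as a hypothesis): the
target `ψ'/ψ` is dilation-invariant, and inverses of uniformizers agreeing on `ℍₒ` agree on `D`. -/

namespace MartingaleToSLE6Branches

/-- **Dilation invariance of the target.** Precomposing the uniformizer `φ : ℍₒ → D` with the
dilation `z ↦ c • z` (`c > 0`) replaces `ψ = φ.symm` by `c⁻¹ • ψ` and leaves the logarithmic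
derivative `ψ'/ψ` unchanged on the carrier. [folklore] -/
theorem deriv_symm_div_smul_trans (D : DobrushinDomain)
    (φ : ConformalEquiv UpperHalfPlane.upperHalfPlaneSet D.carrier) (c : ℝ) (hc : 0 < c)
    {w : ℂ} (hw : w ∈ D.carrier) :
    deriv ((ConformalEquiv.smulUpperHalfPlane c hc).trans φ).symm w /
        ((ConformalEquiv.smulUpperHalfPlane c hc).trans φ).symm w =
      deriv φ.symm w / φ.symm w := by
  have hfun : (((ConformalEquiv.smulUpperHalfPlane c hc).trans φ).symm : ℂ → ℂ) =
      fun z => ((c⁻¹ : ℝ) : ℂ) * φ.symm z := by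
    funext z
    change (c⁻¹ : ℝ) • φ.symm z = _
    rw [Complex.real_smul]
  rw [hfun]
  have hd : DifferentiableAt ℂ φ.symm w :=
    (φ.symm.differentiableOn w hw).differentiableAt (D.isOpen.mem_nhds hw)
  rw [deriv_const_mul _ hd]
  have hc' : ((c⁻¹ : ℝ) : ℂ) ≠ 0 := by exact_mod_cast (inv_pos.2 hc).ne'
  rw [mul_div_mul_left _ _ hc']

/-- **Inverses of uniformizers that agree on `ℍₒ` agree on the carrier.** If `φ' = T` on `ℍₒ`
for two conformal equivalences `ℍₒ → D`, then `φ'.symm = T.symm` on `D` (`T.symm ∘ T = id` on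
`ℍₒ`, `φ' ∘ φ'.symm = id` on `D`). [folklore] -/
theorem eqOn_symm_of_eqOn {D : DobrushinDomain}
    {φ' T : ConformalEquiv UpperHalfPlane.upperHalfPlaneSet D.carrier}
    (h : EqOn φ' T UpperHalfPlane.upperHalfPlaneSet) : EqOn φ'.symm T.symm D.carrier := by
  intro v hv
  have hx : φ'.symm v ∈ UpperHalfPlane.upperHalfPlaneSet := φ'.symm_mapsTo hv
  have h1 : φ' (φ'.symm v) = v := by
    have hv' : v ∈ φ'.toPartialEquiv.target := by rw [φ'.target_eq]; exact hv
    exact φ'.toPartialEquiv.right_inv hv'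
  have h2 : T (φ'.symm v) = v := (h hx).symm.trans h1
  have hxs : φ'.symm v ∈ T.toPartialEquiv.source := by rw [T.source_eq]; exact hx
  have h3 : T.symm (T (φ'.symm v)) = φ'.symm v := T.toPartialEquiv.left_inv hxs
  rw [h2] at h3
  exact h3.symm

end MartingaleToSLE6Branches

/-- **One uniformizer and one branch suffice for `TemplateCanonicalLimit`**, modulo the named
fact `MarkedDomain.IsChordalUniformizing.exists_eq_trans_smul` (uniqueness of chordal
uniformizers up to a dilation of `ℍₒ`; Lawler 2005, Ch. 6). If the template has, for every
Dobrushin domain and discretisation family, SOME chordal uniformizer `φ` and SOME holomorphic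
branch `q` of `(ψ'/ψ)^(1/3)` (`ψ = φ.symm`) with unit phases realising the convergence, then the
route's antecedent (every uniformizer, every branch) holds: any other uniformizer is `φ ∘ (c • ·)`
on `ℍₒ` (`exists_eq_trans_smul`), its inverse agrees with `c⁻¹ • ψ` on the carrier
(`eqOn_symm_of_eqOn`), so its target `ψ'/ψ` — value and derivative read on the open carrier — is
the same (`deriv_symm_div_smul_trans`), and `templateCanonicalLimit_of_oneBranch` finishes.
CONDITIONAL on the named fact (first hypothesis). [folklore] -/
theorem templateCanonicalLimit_of_oneUniformizer :
    MarkedDomain.IsChordalUniformizing.exists_eq_trans_smul →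
    (∃ (r m : ℕ) (z : Fin 2 → Fin m → MedialVertex)
      (s : Fin 2 → Fin m → ℝ) (g : Fin 2 → Fin m → Set MedialVertex → ℂ) (C : ℝ), 0 < C ∧
      (∀ i k, medialGraph.edist s((0 : Site 2), Pi.single i 1) (z i k) ≤ (r : ℕ∞)) ∧
      (let G : DiscreteDobrushin → Site 2 → Fin 2 → ℂ := fun D x i => ∫ cfg, (∑ k, g i k
          {e | medialGraph.edist s((0 : Site 2), Pi.single i 1) e ≤ (r : ℕ∞) ∧
            Sym2.map (· + x) e ∈ cfg} *
          passageSum (fkInterface D cfg) D.δ (s i k) (Sym2.map (· + x) (z i k)))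
          ∂(bondPercolation (zdGraph 2) half);
      ∀ (D : DobrushinDomain) (E : ℝ → DiscreteDobrushin), ZdDiscretisationFamily D E →
      ∃ φ : ConformalEquiv UpperHalfPlane.upperHalfPlaneSet D.carrier,
        D.IsChordalUniformizing φ ∧
      ∃ q : ℂ → ℂ, DifferentiableOn ℂ q D.carrier ∧
        (∀ w ∈ D.carrier, q w ^ 3 = deriv φ.symm w / φ.symm w) ∧
        ∃ θ : ℝ → ℂ, (∀ δ, ‖θ δ‖ = 1) ∧ ∀ i : Fin 2,
          TendstoLocallyUniformlyOn (fun (δ : ℝ) (w : ℂ) => θ δ * C * ((δ ^ (-(1 / 3 : ℝ)) : ℝ) : ℂ) *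
            G (E δ) (fun j => ⌊(if j = 0 then w.re else w.im) / δ⌋) i) q (𝓝[>] (0 : ℝ)) D.carrier)) →
    TemplateCanonicalLimit := by
  intro hU h
  apply templateCanonicalLimit_of_oneBranch
  obtain ⟨r, m, z, s, g, C, hC, hrange, hlim⟩ := h
  refine ⟨r, m, z, s, g, C, hC, hrange, ?_⟩
  intro G D E hE φ' hφ'
  obtain ⟨φ, hφ, q, hq, hq3, θ, hθ, hconv⟩ := hlim D E hE
  obtain ⟨c, hc, heq⟩ := hU hφ hφ'
  refine ⟨q, hq, fun w hw => ?_, θ, hθ, hconv⟩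
  -- the target of `φ'` is that of the dilated `φ`, which is that of `φ`
  have hagree : EqOn φ'.symm ((ConformalEquiv.smulUpperHalfPlane c hc).trans φ).symm D.carrier :=
    eqOn_symm_of_eqOn heq
  have hnhds : (φ'.symm : ℂ → ℂ) =ᶠ[𝓝 w]
      (((ConformalEquiv.smulUpperHalfPlane c hc).trans φ).symm : ℂ → ℂ) :=
    Filter.eventuallyEq_of_mem (D.isOpen.mem_nhds hw) hagree
  rw [hq3 w hw, hnhds.deriv_eq, hagree hw, deriv_symm_div_smul_trans D φ c hc hw]

end Summit.CriticalPhenomena.CardyFormulaZ2.Theorems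

end
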